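import Summits.RiemannHypothesis.RiemannHypothesis.Theorems.PfPersistenceMidpointSegment
import Summits.RiemannHypothesis.RiemannHypothesis.Theorems.PfPersistenceArithDialSpace
import HarnessLib

/-!
# PF persistence — MULTI-DIAL MATCHING IS FREE FOR AFFINE DATA (pub-rhpf, cand-6 gen 3; part 1 of 2)

**HONEST FRAMING. MECHANISM / RIGIDITY campaign; no RH claims.**  RH-free linear algebra about the
affine structure of the map table ↦ datum; nothing here bears on whether `ζ` is window-positive; no DATA.

**THE MATCHING LEMMA (PROVED)** `exists_arith_twoSided_matching`: for finitely many AFFINE COORDINATES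
`Φ : Datum →ₗ[ℝ] (ι → ℝ)` (`ι` finite, read at ANY windows) and finitely many FREE WINDOWS `W` there is a
direction `v` such that the whole LINE `ζ + t v` of weight tables is ARITHMETIC, has the SAME coordinates
`Φ` and the SAME matrices on `W` as `ζ`, and is DETECTABLY NEGATIVE (with datum `≠ ζ`) at two parameters
of OPPOSITE signs.  MECHANISM: the datum is affine in the table (`datumOf_add_apply`: adding `v` subtracts
its prime block, linear in `v`), so `y ↦ Φ(prime block of Σ_j y_j e_{q_j})` on `|ι| + 1` positions
`q_j = 2^{(J+1)3^j}` beyond the reach of `W` is a linear map `ℝ^{|ι|+1} → ℝ^{|ι|}` with a kernel vector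
`y ≠ 0` (rank–nullity, `exists_ne_zero_map_eq_zero`); at the smallest active position `q = 2^k` the
windows `2a = (k+½) log 2` (entry `(0,0)`, `θ₀₀ = 1/(2k+1)`) and `2a = 2k log 2` (entry `(1,1)`,
`θ₁₁ = −½`) see ONLY `q` (the next position is `q³ > q² = e^{2a}`), with slopes of OPPOSITE signs.
Part 2 (`PfPersistenceFibrewiseCoconvex`) turns the lemma into the FIBREWISE CO-CONVEX BARRIER, one class
containing the locality barrier T-W1, the co-convex barrier B-CVX-DATUM and every finite-affine-rank
reader.  (The cell's multi-dial-matching heuristic C5-N4(b) / RULING A42 concerns EIGEN-data, which are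
not affine; this settles exactly the affine case, at kernel level.)
-/

set_option linter.dupNamespace false

noncomputable section

open Matrix Finset

namespace Summit.RiemannHypothesis.RiemannHypothesis.Theorems.PfPersistence

/-! ## §1 The prime block is linear in the table; adding a table subtracts its prime block (PROVED) -/

/-- PROVED: the prime block is ADDITIVE in the weight table. [folklore] -/
theorem primesBlock_add (u v : Weights) (win : Window) :
    primesBlock (u + v) win = primesBlock u win + primesBlock v win := by
  ext n m
  have h := WP_linearCombo (2 * win.a) u v 1 1 (thetaEven (2 * win.a) n m)
  simp only [one_smul, one_mul] at h
  simpa [primesBlock, Matrix.add_apply] using h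

/-- PROVED: the prime block is HOMOGENEOUS in the weight table. [folklore] -/
theorem primesBlock_smul (c : ℝ) (v : Weights) (win : Window) :
    primesBlock (c • v) win = c • primesBlock v win := by
  ext n m
  have h := WP_linearCombo (2 * win.a) v v c 0 (thetaEven (2 * win.a) n m)
  simp only [zero_smul, add_zero, zero_mul] at h
  simpa [primesBlock, Matrix.smul_apply, smul_eq_mul] using h

/-- PROVED: adding a table `v` to `w` SUBTRACTS the prime block of `v` at every window. [folklore] -/
theorem datumOf_add_apply (w v : Weights) (win : Window) :
    datumOf (w + v) win = datumOf w win - primesBlock v win := by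
  show evenBlock (w + v) win = evenBlock w win - primesBlock v win
  rw [evenBlock_eq_decomp, evenBlock_eq_decomp, primesBlock_add]
  abel

/-- PROVED: the prime-block entry sum. [folklore] -/
theorem primesBlock_apply (v : Weights) (win : Window) (n m : Fin (win.N + 1)) :
    primesBlock v win n m
      = 2 * ∑ q ∈ primeRange (2 * win.a), v q * thetaEven (2 * win.a) n m (Real.log q) := rfl

/-! ## §2 Rank–nullity and the convex-combination bookkeeping (PROVED) -/

/-- PROVED: a linear map from `ℝ^m` to `ℝ^ι` with `|ι| < m` kills a non-zero vector. [folklore] -/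
theorem exists_ne_zero_map_eq_zero {ι : Type*} [Fintype ι] {m : ℕ} (hm : Fintype.card ι < m)
    (ψ : (Fin m → ℝ) →ₗ[ℝ] (ι → ℝ)) : ∃ y : Fin m → ℝ, y ≠ 0 ∧ ψ y = 0 := by
  have hrange : Module.finrank ℝ (LinearMap.range ψ) ≤ Fintype.card ι := by
    calc Module.finrank ℝ (LinearMap.range ψ) ≤ Module.finrank ℝ (ι → ℝ) := Submodule.finrank_le _
      _ = Fintype.card ι := Module.finrank_pi ℝ
  have hsum := LinearMap.finrank_range_add_finrank_ker ψ
  have hdom : Module.finrank ℝ (Fin m → ℝ) = m := by simp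
  have hker : 0 < Module.finrank ℝ (LinearMap.ker ψ) := by omega
  have hne : LinearMap.ker ψ ≠ ⊥ := by
    intro h
    rw [h, finrank_bot] at hker
    exact lt_irrefl _ hker
  obtain ⟨y, hyk, hy0⟩ := (Submodule.ne_bot_iff _).1 hne
  exact ⟨y, hy0, LinearMap.mem_ker.1 hyk⟩

/-- PROVED: two reals of opposite signs have `0` as a convex combination. [folklore] -/
theorem convexCombo_zero_of_mul_neg {a b : ℝ} (hab : a * b < 0) :
    ∃ s t : ℝ, 0 ≤ s ∧ 0 ≤ t ∧ s + t = 1 ∧ s * a + t * b = 0 := by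
  rcases mul_neg_iff.1 hab with ⟨ha, hb⟩ | ⟨ha, hb⟩
  · have hd : 0 < a - b := by linarith
    refine ⟨-b / (a - b), a / (a - b), div_nonneg (by linarith) hd.le, div_nonneg ha.le hd.le, ?_, ?_⟩
    · field_simp
      ring
    · field_simp
      ring
  · have hd : 0 < b - a := by linarith
    refine ⟨b / (b - a), -a / (b - a), div_nonneg hb.le hd.le, div_nonneg (by linarith) hd.le, ?_, ?_⟩
    · field_simp
      ring
    · field_simp
      ring

/-- PROVED: the table `Σ_j y_j e_{q_j}`, `q_j = 2^{(J+1)3^j}`, evaluated at its own position `q_{j₀}`. [folklore] -/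
theorem powTable_apply_pow {m : ℕ} (J : ℕ) (y : Fin m → ℝ) (j₀ : Fin m) :
    (∑ j : Fin m, if 2 ^ ((J + 1) * 3 ^ j.val) = 2 ^ ((J + 1) * 3 ^ j₀.val) then y j else 0) = y j₀ := by
  have key : ∀ j : Fin m, (2 ^ ((J + 1) * 3 ^ j.val) = 2 ^ ((J + 1) * 3 ^ j₀.val)) ↔ j = j₀ := by
    intro j
    constructor
    · intro h
      have h1 := Nat.pow_right_injective (le_refl 2) h
      have h2 : 3 ^ j.val = 3 ^ j₀.val := Nat.eq_of_mul_eq_mul_left (Nat.succ_pos J) (by simpa using h1)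
      exact Fin.ext (Nat.pow_right_injective (by norm_num) h2)
    · rintro rfl
      rfl
  simp_rw [key]
  simp

/-! ## §3 THE MATCHING LEMMA: a two-sided negative line through `ζ` with prescribed affine data (PROVED) -/

/-- **PROVED — MULTI-DIAL MATCHING IS FREE FOR AFFINE DATA.**  For finitely many affine coordinates `Φ` and
finitely many windows `W` there is a direction `v` (supported on `|ι| + 1` powers of `2` beyond the reach of
`W`) such that the whole line `ζ + t v` is ARITHMETIC with the SAME `Φ` and the SAME matrices on `W` as `ζ`,
and two parameters `t₁, t₂` of OPPOSITE signs at which the datum is `≠ ζ` and DETECTABLY NEGATIVE. [folklore] -/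
theorem exists_arith_twoSided_matching {ι : Type*} [Fintype ι] (Φ : Datum →ₗ[ℝ] (ι → ℝ))
    (W : Finset Window) :
    ∃ v : Weights, ∃ t₁ t₂ : ℝ, t₁ * t₂ < 0 ∧
      (∀ t : ℝ, zetaWeights + t • v ∈ arithWeights) ∧
      (∀ t : ℝ, Φ (datumOf (zetaWeights + t • v)) = Φ zetaDatum) ∧
      (∀ t : ℝ, ∀ win ∈ W, datumOf (zetaWeights + t • v) win = zetaDatum win) ∧
      datumOf (zetaWeights + t₁ • v) ≠ zetaDatum ∧ DetectablyNegative (datumOf (zetaWeights + t₁ • v)) ∧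
      datumOf (zetaWeights + t₂ • v) ≠ zetaDatum ∧ DetectablyNegative (datumOf (zetaWeights + t₂ • v)) := by
  classical
  obtain ⟨m, hm⟩ : ∃ m : ℕ, m = Fintype.card ι + 1 := ⟨_, rfl⟩
  have hlog2 : 0 < Real.log 2 := Real.log_pos (by norm_num)
  have hlogpow : ∀ i : ℕ, Real.log ((2 ^ i : ℕ) : ℝ) = (i : ℝ) * Real.log 2 := by
    intro i
    push_cast
    exact Real.log_pow 2 i
  -- an offset `J` putting the positions `2^{J+1}, …` beyond the reach of every window of `W`
  obtain ⟨J, hJ⟩ : ∃ J : ℕ, ∀ win ∈ W, 2 * win.a < ((J : ℝ) + 1) * Real.log 2 := by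
    refine ⟨∑ w ∈ W, ⌈2 * w.a / Real.log 2⌉₊, fun win hwin => ?_⟩
    have h1 : 2 * win.a ≤ (⌈2 * win.a / Real.log 2⌉₊ : ℝ) * Real.log 2 :=
      (div_le_iff₀ hlog2).1 (Nat.le_ceil _)
    have h2 : (⌈2 * win.a / Real.log 2⌉₊ : ℝ) ≤ ((∑ w ∈ W, ⌈2 * w.a / Real.log 2⌉₊ : ℕ) : ℝ) := by
      exact_mod_cast Finset.single_le_sum (f := fun w : Window => ⌈2 * w.a / Real.log 2⌉₊)
        (fun _ _ => Nat.zero_le _) hwin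
    have h3 := mul_le_mul_of_nonneg_right h2 hlog2.le
    linarith
  -- exponents `e j = (J+1)·3^j`: at least `J+1`, and TRIPLING from one position to the next
  have hege : ∀ j : Fin m, J + 1 ≤ (J + 1) * 3 ^ j.val := fun j =>
    Nat.le_mul_of_pos_right _ (Nat.pow_pos (by norm_num))
  have hetriple : ∀ j j' : Fin m, j.val < j'.val → 3 * ((J + 1) * 3 ^ j.val) ≤ (J + 1) * 3 ^ j'.val := by
    intro j j' hjj'
    have : 3 ^ (j.val + 1) ≤ 3 ^ j'.val := Nat.pow_le_pow_right (by norm_num) hjj'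
    calc 3 * ((J + 1) * 3 ^ j.val) = (J + 1) * 3 ^ (j.val + 1) := by ring
      _ ≤ (J + 1) * 3 ^ j'.val := Nat.mul_le_mul_left _ this
  -- the multi-position table and the prime-block map, as linear maps
  let V : (Fin m → ℝ) →ₗ[ℝ] Weights :=
    { toFun := fun y q => ∑ j : Fin m, if 2 ^ ((J + 1) * 3 ^ j.val) = q then y j else 0
      map_add' := by
        intro y y'
        funext q
        rw [Pi.add_apply, ← Finset.sum_add_distrib]
        refine Finset.sum_congr rfl fun j _ => ?_
        split_ifs <;> simp
      map_smul' := by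
        intro c y
        funext q
        rw [Pi.smul_apply, smul_eq_mul, RingHom.id_apply, Finset.mul_sum]
        refine Finset.sum_congr rfl fun j _ => ?_
        split_ifs <;> simp }
  have hV : ∀ y : Fin m → ℝ, ∀ q : ℕ,
      V y q = ∑ j : Fin m, if 2 ^ ((J + 1) * 3 ^ j.val) = q then y j else 0 := fun _ _ => rfl
  let P : Weights →ₗ[ℝ] Datum :=
    { toFun := fun v win => primesBlock v win
      map_add' := by
        intro u v
        funext win
        exact primesBlock_add u v win
      map_smul' := by
        intro c v
        funext win
        rw [RingHom.id_apply, Pi.smul_apply]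
        exact primesBlock_smul c v win }
  have hP : ∀ v : Weights, ∀ win : Window, P v win = primesBlock v win := fun _ _ => rfl
  obtain ⟨y, hy0, hψ⟩ :=
    exists_ne_zero_map_eq_zero (ι := ι) (by omega : Fintype.card ι < m) (Φ ∘ₗ P ∘ₗ V)
  have hψ' : Φ (P (V y)) = 0 := by simpa using hψ
  -- the line and its datum
  have hd : ∀ t : ℝ, datumOf (zetaWeights + t • V y) = zetaDatum - t • P (V y) := by
    intro t
    funext w'
    rw [Pi.sub_apply, Pi.smul_apply, hP, datumOf_add_apply, primesBlock_smul]
    rfl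
  -- a position whose logarithm exceeds `2a` is invisible at the window
  have hout : ∀ (win : Window) (j : Fin m), 2 * win.a < (((J + 1) * 3 ^ j.val : ℕ) : ℝ) * Real.log 2 →
      (2 ^ ((J + 1) * 3 ^ j.val) : ℕ) ∉ primeRange (2 * win.a) := by
    intro win j hlt hmemj
    have h1 := log_le_of_mem_primeRange (mul_pos two_pos win.ha).le hmemj
    rw [hlogpow] at h1
    linarith
  have hinv : ∀ win ∈ W, primesBlock (V y) win = 0 := by
    intro win hwin
    ext n m'
    rw [primesBlock_apply, Matrix.zero_apply, Finset.sum_eq_zero, mul_zero]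
    intro q hq
    rw [hV, Finset.sum_eq_zero, zero_mul]
    intro j _
    rw [if_neg]
    intro h
    rw [← h] at hq
    refine hout win j ?_ hq
    have h2 : ((J : ℝ) + 1) ≤ (((J + 1) * 3 ^ j.val : ℕ) : ℝ) := by exact_mod_cast hege j
    have h3 := mul_le_mul_of_nonneg_right h2 hlog2.le
    linarith [hJ win hwin]
  -- the smallest ACTIVE position `2^k`, `k = (J+1)·3^{j₀}`
  have hsupp : (Finset.univ.filter fun j : Fin m => y j ≠ 0).Nonempty := by
    by_contra h
    rw [Finset.not_nonempty_iff_eq_empty, Finset.filter_eq_empty_iff] at h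
    exact hy0 (funext fun j => by simpa using h (Finset.mem_univ j))
  obtain ⟨j₀, hj₀mem, hj₀min⟩ :=
    Finset.exists_min_image (Finset.univ.filter fun j : Fin m => y j ≠ 0) (fun j => j.val) hsupp
  have hyj₀ : y j₀ ≠ 0 := by simpa using hj₀mem
  have hmin : ∀ j : Fin m, j.val < j₀.val → y j = 0 := by
    intro j hj
    by_contra hne
    have := hj₀min j (by simpa using hne)
    omega
  obtain ⟨k, hk⟩ : ∃ k : ℕ, k = (J + 1) * 3 ^ j₀.val := ⟨_, rfl⟩
  have hk1 : (1 : ℝ) ≤ k := by exact_mod_cast (hk ▸ le_trans (Nat.succ_le_succ (Nat.zero_le J)) (hege j₀))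
  -- at a window with `2a < 3k·log 2`, the table `V y` is seen only through the position `2^k`
  have hVq : ∀ win : Window, 2 * win.a < 3 * (k : ℝ) * Real.log 2 →
      ∀ q ∈ primeRange (2 * win.a), q ≠ 2 ^ k → V y q = 0 := by
    intro win hwin q hq hne
    rw [hV]
    refine Finset.sum_eq_zero fun j _ => ?_
    split_ifs with h
    · rcases lt_trichotomy j.val j₀.val with hlt | heq | hgt
      · exact hmin j hlt
      · exfalso
        apply hne
        rw [← h, heq, hk]
      · refine absurd (h ▸ hq) (hout win j ?_)
        have h2 : 3 * (k : ℝ) ≤ (((J + 1) * 3 ^ j.val : ℕ) : ℝ) := by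
          rw [hk]
          exact_mod_cast hetriple j₀ j hgt
        have h3 := mul_le_mul_of_nonneg_right h2 hlog2.le
        linarith
    · rfl
  have hVk : V y (2 ^ k) = y j₀ := by
    rw [hV, hk]
    exact powTable_apply_pow J y j₀
  have hsum : ∀ win : Window, 2 * win.a < 3 * (k : ℝ) * Real.log 2 → (2 ^ k : ℕ) ∈ primeRange (2 * win.a) →
      ∀ θ : ℝ → ℝ, (∑ q ∈ primeRange (2 * win.a), V y q * θ (Real.log q))
        = y j₀ * θ (Real.log ((2 ^ k : ℕ) : ℝ)) := by
    intro win hwin hmem θ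
    rw [Finset.sum_eq_single (2 ^ k)]
    · rw [hVk]
    · intro q hq hne
      rw [hVq win hwin q hq hne, zero_mul]
    · intro h
      exact absurd hmem h
  -- UP window `2a = (k + 1/2) log 2`, `N = 0`, entry `(0,0)`: slope `2 y /(2k+1)`
  obtain ⟨wu, hwu⟩ : ∃ win : Window, win = ⟨((k : ℝ) + 1 / 2) * Real.log 2 / 2, 0, by positivity⟩ :=
    ⟨_, rfl⟩
  have hwua : 2 * wu.a = ((k : ℝ) + 1 / 2) * Real.log 2 := by
    rw [hwu]
    ring
  have hwu3 : 2 * wu.a < 3 * (k : ℝ) * Real.log 2 := by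
    rw [hwua]
    nlinarith
  have hmemu : (2 ^ k : ℕ) ∈ primeRange (2 * wu.a) := by
    apply mem_primeRange_of_log_le
    rw [hlogpow, hwua]
    nlinarith
  have hθu : thetaEven (2 * wu.a) 0 0 (Real.log ((2 ^ k : ℕ) : ℝ)) = 1 / (2 * (k : ℝ) + 1) := by
    rw [thetaEven_zero_zero, hlogpow, hwua]
    field_simp
    ring
  have hPu : primesBlock (V y) wu 0 0 = 2 * (y j₀ * (1 / (2 * (k : ℝ) + 1))) := by
    rw [primesBlock_apply, Fin.val_zero, hsum wu hwu3 hmemu, hθu]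
  -- DOWN window `a = k log 2`, `N = 1`, entry `(1,1)`: `θ₁₁(log 2^k) = −1/2`, slope `−y`
  have hka : 0 < (k : ℝ) * Real.log 2 := by positivity
  obtain ⟨wd, hwd⟩ : ∃ win : Window, win = ⟨(k : ℝ) * Real.log 2, 1, hka⟩ := ⟨_, rfl⟩
  have hwda : 2 * wd.a = 2 * ((k : ℝ) * Real.log 2) := by rw [hwd]
  have hwd3 : 2 * wd.a < 3 * (k : ℝ) * Real.log 2 := by
    rw [hwda]
    nlinarith
  have hmemd : (2 ^ k : ℕ) ∈ primeRange (2 * wd.a) := by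
    apply mem_primeRange_of_log_le
    rw [hlogpow, hwda]
    nlinarith
  have hθd : thetaEven (2 * wd.a) ((1 : Fin (wd.N + 1)) : ℕ) ((1 : Fin (wd.N + 1)) : ℕ)
      (Real.log ((2 ^ k : ℕ) : ℝ)) = -(1 / 2) := by
    rw [hlogpow, hwd]
    exact thetaEven_one_one_self hka.ne'
  have hPd : primesBlock (V y) wd 1 1 = 2 * (y j₀ * -(1 / 2)) := by
    rw [primesBlock_apply, hsum wd hwd3 hmemd, hθd]
  -- the two parameters
  obtain ⟨cu, hcu⟩ : ∃ c : ℝ, c = datumOf zetaWeights wu 0 0 := ⟨_, rfl⟩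
  obtain ⟨cd, hcd⟩ : ∃ c : ℝ, c = datumOf zetaWeights wd 1 1 := ⟨_, rfl⟩
  have hθpos : (0 : ℝ) < 1 / (2 * (k : ℝ) + 1) := by positivity
  have hsu : 2 * (y j₀ * (1 / (2 * (k : ℝ) + 1))) ≠ 0 :=
    mul_ne_zero two_ne_zero (mul_ne_zero hyj₀ hθpos.ne')
  have hsd : 2 * (y j₀ * -(1 / 2)) ≠ 0 := mul_ne_zero two_ne_zero (mul_ne_zero hyj₀ (by norm_num))
  obtain ⟨tu, htu⟩ : ∃ t : ℝ, t = (|cu| + 1) / (2 * (y j₀ * (1 / (2 * (k : ℝ) + 1)))) := ⟨_, rfl⟩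
  obtain ⟨td, htd⟩ : ∃ t : ℝ, t = (|cd| + 1) / (2 * (y j₀ * -(1 / 2))) := ⟨_, rfl⟩
  have htus : tu * (2 * (y j₀ * (1 / (2 * (k : ℝ) + 1)))) = |cu| + 1 := by
    rw [htu, div_mul_cancel₀ _ hsu]
  have htds : td * (2 * (y j₀ * -(1 / 2))) = |cd| + 1 := by
    rw [htd, div_mul_cancel₀ _ hsd]
  have hentu : datumOf (zetaWeights + tu • V y) wu 0 0 = cu - (|cu| + 1) := by
    rw [datumOf_add_apply, Matrix.sub_apply, primesBlock_smul, Matrix.smul_apply, smul_eq_mul, hPu,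
      htus, ← hcu]
  have hentd : datumOf (zetaWeights + td • V y) wd 1 1 = cd - (|cd| + 1) := by
    rw [datumOf_add_apply, Matrix.sub_apply, primesBlock_smul, Matrix.smul_apply, smul_eq_mul, hPd,
      htds, ← hcd]
  have hsign : tu * td < 0 := by
    have hprod : tu * td * ((2 * (y j₀ * (1 / (2 * (k : ℝ) + 1)))) * (2 * (y j₀ * -(1 / 2))))
        = (|cu| + 1) * (|cd| + 1) := by
      rw [← htus, ← htds]
      ring
    have hneg : (2 * (y j₀ * (1 / (2 * (k : ℝ) + 1)))) * (2 * (y j₀ * -(1 / 2))) < 0 := by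
      have hy2 : 0 < y j₀ * y j₀ := mul_self_pos.2 hyj₀
      nlinarith
    have hpos : 0 < (|cu| + 1) * (|cd| + 1) := by positivity
    have h := div_neg_of_pos_of_neg hpos hneg
    rw [← hprod, mul_div_assoc, div_self hneg.ne, mul_one] at h
    exact h
  refine ⟨V y, tu, td, hsign, ?_, ?_, ?_, ?_, ?_, ?_, ?_⟩
  · -- arithmetic: `ζ` and `V y` vanish off prime powers
    intro t q hq
    rw [Pi.add_apply, Pi.smul_apply, smul_eq_mul, zetaWeights_mem_arithWeights q hq, zero_add, hV,
      Finset.sum_eq_zero, mul_zero]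
    intro j _
    split_ifs with h
    · refine absurd (h ▸ Nat.prime_two.isPrimePow.pow ?_) hq
      exact (Nat.mul_pos (Nat.succ_pos J) (Nat.pow_pos (by norm_num))).ne'
    · rfl
  · -- the affine coordinates are constant along the line
    intro t
    rw [hd, map_sub, map_smul, hψ', smul_zero, sub_zero]
  · -- the matrices on `W` are constant along the line
    intro t w' hw'
    rw [datumOf_add_apply, primesBlock_smul, hinv w' hw', smul_zero, sub_zero]
    rfl
  · intro h
    have h'' : datumOf (zetaWeights + tu • V y) wu 0 0 = datumOf zetaWeights wu 0 0 := by rw [h]; rfl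
    rw [hentu, ← hcu] at h''
    linarith [abs_nonneg cu]
  · refine ⟨wu, Pi.single 0 1, ?_⟩
    rw [single_zero_rayleigh, hentu]
    linarith [le_abs_self cu]
  · intro h
    have h'' : datumOf (zetaWeights + td • V y) wd 1 1 = datumOf zetaWeights wd 1 1 := by rw [h]; rfl
    rw [hentd, ← hcd] at h''
    linarith [abs_nonneg cd]
  · refine ⟨wd, Pi.single 1 1, ?_⟩
    rw [single_rayleigh, hentd]
    linarith [le_abs_self cd]

end Summit.RiemannHypothesis.RiemannHypothesis.Theorems.PfPersistence

end
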